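import Mathlib
import Summits.Ventures.PercRepro2.Defs
import Summits.Ventures.PercRepro2.Independence
import Summits.Ventures.PercRepro2.Harris
import Summits.Ventures.PercRepro2.Graph
import Summits.Ventures.PercRepro2.Events
import Summits.Ventures.PercRepro2.GateCylinder
import Summits.Ventures.PercRepro2.CCTRootEdge
import Summits.Ventures.PercRepro2.CDNestedStep
import Summits.Ventures.PercRepro2.CDNestedRouteChain
import Summits.Ventures.PercRepro2.CDNestedRoute
import Summits.Ventures.PercRepro2.CDNestedEdgeLemmas
import Summits.Ventures.PercRepro2.CDNestedMixture
import Summits.Ventures.PercRepro2.CDNestedInternal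
import Summits.Ventures.PercRepro2.CDNestedRoutes
import Summits.Ventures.PercRepro2.CDNestedFan
import Summits.Ventures.PercRepro2.CDNestedPaths

/-!
# The nested-routes theorem in its (AC) form — the `a₃`-required anti-correlation itself
(blind cell PercRepro2, mine-a g36; MINE-A.md §91, proofs/MINEA-CD-NESTED.md §6)

`CDNestedRoutes.cd_of_nested_routes` and its graph-level forms conclude row 2′CD; their proofs pass
through the `a₃`-required anti-correlation (AC) `P(Q U e f)·P(Q e) ≤ P(Q U e)·P(Q e f)`
(`CDNestedMixture.ac_of_worlds`) and then `CDRequired.cd_of_required_anticorr`.  The cut-vertex transfer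
theorems of `CDCutAC` take (AC) — for every up-set, under a given weight vector — as their hypothesis,
so the class theorems are restated here with (AC) as the conclusion, by the same proofs:
`ac_of_nested_routes` (routes with nested vertex sets, `Q ∩ e = Q ∩ ⋃ cyl(B i)`),
`ac_of_nested_routes'` (the one-way route hypothesis), `ac_of_nested_paths` (every simple `a₁–a₃` path
avoiding `a₂` contains a route) and `ac_of_nested_simple_paths` (the simple `a₁–a₃` paths avoiding
`a₂` have pairwise comparable vertex sets — no route data).  No definition; one seat.
-/

namespace Summit.Ventures.PercRepro2

namespace CDNestedAC

section Routes

variable {V : Type*} {E : Type*} [Fintype E] [DecidableEq E] [Fintype V] [DecidableEq V]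
  {R : Type*} [Field R] [LinearOrder R] [IsStrictOrderedRing R]

/-- **THE NESTED-ROUTES THEOREM, (AC) FORM.** Routes `L i` (`i < k`), walk-ordered from `a₁`, with edge
sets `B i` and vertex sets `S i`, NESTED; under `Q = {a₁ ↮ a₂}` the event `{a₁ ↔ a₃}` is the union of
the cylinders of the routes.  Then `P(Q U e f)·P(Q e) ≤ P(Q U e)·P(Q e f)` for every up-set `𝓔`. -/
theorem ac_of_nested_routes (p : E → R) (hp : IsProbVec p) {ends : E → Sym2 V} {a₁ a₂ a₃ o : V}
    (k : ℕ) (L : ℕ → List (E × V × V)) (B : ℕ → Finset E) (S : ℕ → Finset V)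
    (hB : ∀ i, i < k → B i = (L i).foldl (fun acc t => insert t.1 acc) (∅ : Finset E))
    (hS : ∀ i, i < k → S i = (L i).foldl (fun acc t => insert t.2.2 acc) ({a₁} : Finset V))
    (hends : ∀ i, i < k → ∀ t ∈ L i, ends t.1 = s(t.2.1, t.2.2))
    (hwalk : ∀ i, i < k → ∀ j (hj : j < (L i).length), ((L i).get ⟨j, hj⟩).2.1 ∈
      ({a₁} : Finset V) ∪ (((L i).take j).map (fun u => u.2.2)).toFinset)
    (hnest : ∀ l i, l < i → i < k → S l ⊆ S i) {𝓔 : Set (Set V)} (h𝓔 : IsUpperSet 𝓔)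
    (hQe : (connEvent ends a₁ a₂)ᶜ ∩ connEvent ends a₁ a₃ =
      (connEvent ends a₁ a₂)ᶜ ∩ ⋃ i ∈ Finset.range k, GateCylinder.cylinder (B i)) :
    prob p ((connEvent ends a₁ a₂)ᶜ ∩ clusterInEvent ends a₁ 𝓔 ∩ connEvent ends a₁ a₃ ∩
          connEvent ends a₂ o) * prob p ((connEvent ends a₁ a₂)ᶜ ∩ connEvent ends a₁ a₃) ≤
      prob p ((connEvent ends a₁ a₂)ᶜ ∩ clusterInEvent ends a₁ 𝓔 ∩ connEvent ends a₁ a₃) *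
        prob p ((connEvent ends a₁ a₂)ᶜ ∩ connEvent ends a₁ a₃ ∩ connEvent ends a₂ o) := by
  set Q := (connEvent ends a₁ a₂)ᶜ with hQdef
  set U := clusterInEvent ends a₁ 𝓔 with hUdef
  set e := connEvent ends a₁ a₃ with hedef
  set f := connEvent ends a₂ o with hfdef
  set W := ⋃ i ∈ Finset.range k, GateCylinder.cylinder (B i) with hW
  -- the routes join their vertex sets, contain `a₁`, and their edges are internal
  have hJ : ∀ i, i < k → ∀ ω : Config E, ω ∈ GateCylinder.cylinder (B i) →
      ∀ v ∈ S i, Conn ends ω a₁ v := by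
    intro i hi ω hω v hv
    rw [hB i hi] at hω
    rw [hS i hi] at hv
    exact CDNestedRoute.chain_joined (L i) ∅ {a₁} (CDNestedStep.joined_singleton ends ∅ a₁)
      (hends i hi) (hwalk i hi) ω hω v hv
  have ha₁ : ∀ i, i < k → a₁ ∈ S i := by
    intro i hi
    rw [hS i hi]
    exact CDNestedInternal.subset_foldl_insert (L i) {a₁} (Finset.mem_singleton_self a₁)
  have hint : ∀ i, i < k → ∀ b ∈ B i, ∃ x ∈ S i, ∃ y ∈ S i, ends b = s(x, y) := by
    intro i hi b hb
    rw [hB i hi, CDNestedInternal.mem_foldl_insert_edges] at hb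
    rcases hb with hb | ⟨t, ht, rfl⟩
    · exact absurd hb (Finset.notMem_empty b)
    · refine ⟨t.2.1, ?_, t.2.2, ?_, hends i hi t ht⟩
      · rw [hS i hi]; exact CDNestedInternal.fst_mem_foldl_of_walk (hwalk i hi) t ht
      · rw [hS i hi]; exact CDNestedInternal.snd_mem_foldl_insert (L i) {a₁} t ht
  -- the four events are determined by the connections
  have hconn : ∀ X : Set (Config E), (X = Q ∨ X = Q ∩ U ∨ X = Q ∩ f ∨ X = Q ∩ U ∩ f) →
      ∀ ω ω' : Config E, (∀ u w, Conn ends ω u w ↔ Conn ends ω' u w) → (ω ∈ X ↔ ω' ∈ X) := by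
    intro X hX ω ω' hc
    have hcl := CDNestedEdge.cluster_eq_of_conn_iff hc a₁
    rcases hX with rfl | rfl | rfl | rfl
    · simp only [Q, Set.mem_compl_iff, mem_connEvent, hc]
    · simp only [Q, U, Set.mem_inter_iff, Set.mem_compl_iff, mem_connEvent, mem_clusterInEvent, hc,
        hcl]
    · simp only [Q, f, Set.mem_inter_iff, Set.mem_compl_iff, mem_connEvent, hc]
    · simp only [Q, U, f, Set.mem_inter_iff, Set.mem_compl_iff, mem_connEvent, mem_clusterInEvent,
        hc, hcl]
  -- the pointwise form of `hQe`
  have hpt : ∀ ω, ω ∈ Q → (ω ∈ e ↔ ω ∈ W) := by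
    intro ω hQ
    have h := Set.ext_iff.1 hQe ω
    simp only [Set.mem_inter_iff] at h
    exact ⟨fun he => (h.1 ⟨hQ, he⟩).2, fun hc => (h.2 ⟨hQ, hc⟩).2⟩
  have eA : Q ∩ U ∩ e ∩ f = (Q ∩ U ∩ f) ∩ W := by
    ext ω; have h := hpt ω; simp only [Set.mem_inter_iff]; tauto
  have eB : Q ∩ U ∩ e = (Q ∩ U) ∩ W := by
    ext ω; have h := hpt ω; simp only [Set.mem_inter_iff]; tauto
  have eC : Q ∩ e ∩ f = (Q ∩ f) ∩ W := by
    ext ω; have h := hpt ω; simp only [Set.mem_inter_iff]; tauto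
  have eD : Q ∩ e = Q ∩ W := hQe
  -- the worlds and their weights
  have hwp : ∀ i, IsProbVec (GateCylinder.forceOpen p (B i)) :=
    fun i => GateCylinder.isProbVec_forceOpen hp (B i)
  have hν0 : ∀ i, 0 ≤ (∏ b ∈ B i, p b) * prob (GateCylinder.forceOpen p (B i))
      (⋂ l ∈ Finset.range i, (GateCylinder.cylinder (B l))ᶜ) :=
    fun i => mul_nonneg (Finset.prod_nonneg fun b _ => hp.nonneg b) (prob_nonneg (hwp i) _)
  have hmass : ∀ X : Set (Config E), (X = Q ∨ X = Q ∩ U ∨ X = Q ∩ f ∨ X = Q ∩ U ∩ f) →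
      prob p (X ∩ W) = ∑ i ∈ Finset.range k, ((∏ b ∈ B i, p b) *
        prob (GateCylinder.forceOpen p (B i)) (⋂ l ∈ Finset.range i, (GateCylinder.cylinder (B l))ᶜ)) *
          prob (GateCylinder.forceOpen p (B i)) X :=
    fun X hX => CDNestedRoutes.prob_inter_routes_eq_sum p k B S hJ hint hnest X (hconn X hX)
  -- the internal-edge reduction of the forced set `B j ∪ B i` to `B j`, for `i < j`
  have hred : ∀ i j, i < j → j < k → ∀ X : Set (Config E),
      (X = Q ∨ X = Q ∩ U ∨ X = Q ∩ f ∨ X = Q ∩ U ∩ f) →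
      prob (GateCylinder.forceOpen p ((L j).foldl (fun acc t => insert t.1 acc) (B i))) X =
        prob (GateCylinder.forceOpen p (B j)) X := by
    intro i j hij hj X hX
    have hint' : ∀ b ∈ B i, ∃ x ∈ S j, ∃ y ∈ S j, ends b = s(x, y) := by
      intro b hb
      obtain ⟨x, hx, y, hy, hxy⟩ := hint i (by omega) b hb
      exact ⟨x, hnest i j hij hj hx, y, hnest i j hij hj hy, hxy⟩
    rw [CDNestedInternal.foldl_insert_edges_eq_union, ← hB j hj, Finset.union_comm]
    exact CDNestedInternal.prob_forceOpen_union_internal p (hJ j hj) hint' X (hconn X hX)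
  -- the ordered propensities
  have hβ : ∀ i j, i < k → j < k → i ≤ j →
      prob (GateCylinder.forceOpen p (B i)) (Q ∩ U) * prob (GateCylinder.forceOpen p (B j)) Q ≤
        prob (GateCylinder.forceOpen p (B j)) (Q ∩ U) * prob (GateCylinder.forceOpen p (B i)) Q := by
    intro i j hi hj hij
    rcases hij.lt_or_eq with hlt | rfl
    · have h := CDNestedRoute.chain_beta p hp (a₂ := a₂) h𝓔 (L j) (B i) (S i) (hJ i hi) (ha₁ i hi)
        (hends j hj) (CDNestedRoute.walk_mono (Finset.singleton_subset_iff.2 (ha₁ i hi)) (hwalk j hj))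
      rw [hred i j hlt hj Q (Or.inl rfl), hred i j hlt hj (Q ∩ U) (Or.inr (Or.inl rfl))] at h
      exact h
    · exact le_rfl
  have hγ : ∀ i j, i < k → j < k → i ≤ j →
      prob (GateCylinder.forceOpen p (B j)) (Q ∩ f) * prob (GateCylinder.forceOpen p (B i)) Q ≤
        prob (GateCylinder.forceOpen p (B i)) (Q ∩ f) * prob (GateCylinder.forceOpen p (B j)) Q := by
    intro i j hi hj hij
    rcases hij.lt_or_eq with hlt | rfl
    · have h := CDNestedRoute.chain_gamma p hp (a₂ := a₂) (o := o) (L j) (B i) (S i) (hJ i hi)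
        (ha₁ i hi) (hends j hj)
        (CDNestedRoute.walk_mono (Finset.singleton_subset_iff.2 (ha₁ i hi)) (hwalk j hj))
      rw [hred i j hlt hj Q (Or.inl rfl), hred i j hlt hj (Q ∩ f) (Or.inr (Or.inr (Or.inl rfl)))] at h
      exact h
    · exact le_rfl
  refine CDNestedMixture.ac_of_worlds p k (fun i => GateCylinder.forceOpen p (B i)) hwp ends
    a₁ a₂ a₃ o h𝓔 (fun i => (∏ b ∈ B i, p b) * prob (GateCylinder.forceOpen p (B i))
      (⋂ l ∈ Finset.range i, (GateCylinder.cylinder (B l))ᶜ)) hν0 ?_ ?_ ?_ ?_ hβ hγ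
  · show prob p (Q ∩ U ∩ e ∩ f) = _
    rw [eA, hmass _ (Or.inr (Or.inr (Or.inr rfl)))]
  · show prob p (Q ∩ U ∩ e) = _
    rw [eB, hmass _ (Or.inr (Or.inl rfl))]
  · show prob p (Q ∩ e ∩ f) = _
    rw [eC, hmass _ (Or.inr (Or.inr (Or.inl rfl)))]
  · show prob p (Q ∩ e) = _
    rw [eD, hmass _ (Or.inl rfl)]

/-- **The nested-routes theorem, (AC) form, with the one-way route hypothesis**: every route reaches
`a₃` and every configuration with `a₁ ↮ a₂` and `a₁ ↔ a₃` has some route open. -/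
theorem ac_of_nested_routes' (p : E → R) (hp : IsProbVec p) {ends : E → Sym2 V} {a₁ a₂ a₃ o : V}
    (k : ℕ) (L : ℕ → List (E × V × V)) (B : ℕ → Finset E) (S : ℕ → Finset V)
    (hB : ∀ i, i < k → B i = (L i).foldl (fun acc t => insert t.1 acc) (∅ : Finset E))
    (hS : ∀ i, i < k → S i = (L i).foldl (fun acc t => insert t.2.2 acc) ({a₁} : Finset V))
    (hends : ∀ i, i < k → ∀ t ∈ L i, ends t.1 = s(t.2.1, t.2.2))
    (hwalk : ∀ i, i < k → ∀ j (hj : j < (L i).length), ((L i).get ⟨j, hj⟩).2.1 ∈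
      ({a₁} : Finset V) ∪ (((L i).take j).map (fun u => u.2.2)).toFinset)
    (h3 : ∀ i, i < k → a₃ ∈ S i)
    (hnest : ∀ l i, l < i → i < k → S l ⊆ S i) {𝓔 : Set (Set V)} (h𝓔 : IsUpperSet 𝓔)
    (hroute : ∀ ω : Config E, ¬ Conn ends ω a₁ a₂ → Conn ends ω a₁ a₃ →
      ∃ i, i < k ∧ ω ∈ GateCylinder.cylinder (B i)) :
    prob p ((connEvent ends a₁ a₂)ᶜ ∩ clusterInEvent ends a₁ 𝓔 ∩ connEvent ends a₁ a₃ ∩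
          connEvent ends a₂ o) * prob p ((connEvent ends a₁ a₂)ᶜ ∩ connEvent ends a₁ a₃) ≤
      prob p ((connEvent ends a₁ a₂)ᶜ ∩ clusterInEvent ends a₁ 𝓔 ∩ connEvent ends a₁ a₃) *
        prob p ((connEvent ends a₁ a₂)ᶜ ∩ connEvent ends a₁ a₃ ∩ connEvent ends a₂ o) := by
  refine ac_of_nested_routes p hp k L B S hB hS hends hwalk hnest h𝓔 ?_
  ext ω
  simp only [Set.mem_inter_iff, Set.mem_compl_iff, mem_connEvent, Set.mem_iUnion, Finset.mem_range,
    exists_prop]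
  constructor
  · rintro ⟨hQ, he⟩
    exact ⟨hQ, hroute ω hQ he⟩
  · rintro ⟨hQ, i, hi, hω⟩
    refine ⟨hQ, ?_⟩
    have hJ := CDNestedRoute.chain_joined (L i) ∅ {a₁} (CDNestedStep.joined_singleton ends ∅ a₁)
      (hends i hi) (hwalk i hi)
    rw [hB i hi] at hω
    exact hJ ω hω a₃ (by rw [← hS i hi]; exact h3 i hi)

/-- **The nested-routes theorem at the graph level, (AC) form**: in a simple graph (`ends` injective)
every simple `a₁–a₃` path avoiding `a₂` contains the edges of some route. -/
theorem ac_of_nested_paths (p : E → R) (hp : IsProbVec p) {ends : E → Sym2 V}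
    (hinj : Function.Injective ends) {a₁ a₂ a₃ o : V} (k : ℕ) (L : ℕ → List (E × V × V))
    (B : ℕ → Finset E) (S : ℕ → Finset V)
    (hB : ∀ i, i < k → B i = (L i).foldl (fun acc t => insert t.1 acc) (∅ : Finset E))
    (hS : ∀ i, i < k → S i = (L i).foldl (fun acc t => insert t.2.2 acc) ({a₁} : Finset V))
    (hends : ∀ i, i < k → ∀ t ∈ L i, ends t.1 = s(t.2.1, t.2.2))
    (hwalk : ∀ i, i < k → ∀ j (hj : j < (L i).length), ((L i).get ⟨j, hj⟩).2.1 ∈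
      ({a₁} : Finset V) ∪ (((L i).take j).map (fun u => u.2.2)).toFinset)
    (h3 : ∀ i, i < k → a₃ ∈ S i)
    (hnest : ∀ l i, l < i → i < k → S l ⊆ S i) {𝓔 : Set (Set V)} (h𝓔 : IsUpperSet 𝓔)
    (hpaths : ∀ W : (openGraph ends (fun _ => true)).Walk a₁ a₃, W.IsPath → a₂ ∉ W.support →
      ∃ i, i < k ∧ ∀ b ∈ B i, ends b ∈ W.edges) :
    prob p ((connEvent ends a₁ a₂)ᶜ ∩ clusterInEvent ends a₁ 𝓔 ∩ connEvent ends a₁ a₃ ∩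
          connEvent ends a₂ o) * prob p ((connEvent ends a₁ a₂)ᶜ ∩ connEvent ends a₁ a₃) ≤
      prob p ((connEvent ends a₁ a₂)ᶜ ∩ clusterInEvent ends a₁ 𝓔 ∩ connEvent ends a₁ a₃) *
        prob p ((connEvent ends a₁ a₂)ᶜ ∩ connEvent ends a₁ a₃ ∩ connEvent ends a₂ o) :=
  ac_of_nested_routes' p hp k L B S hB hS hends hwalk h3 hnest h𝓔
    (CDNestedPaths.route_of_paths hinj k B hpaths)

end Routes

section SimplePaths

variable {V : Type*} {E : Type*} [Fintype E] [DecidableEq E] [Fintype V] [DecidableEq V]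
  {R : Type*} [Field R] [LinearOrder R] [IsStrictOrderedRing R]

/-- **THE NESTED-PATHS THEOREM, (AC) FORM.** In a finite simple graph whose simple `a₁–a₃` paths
avoiding `a₂` have pairwise comparable vertex sets, `P(Q U e f)·P(Q e) ≤ P(Q U e)·P(Q e f)` for every
`o`, every up-set `𝓔` and every admissible weight vector. -/
theorem ac_of_nested_simple_paths (p : E → R) (hp : IsProbVec p) {ends : E → Sym2 V}
    (hinj : Function.Injective ends) {a₁ a₂ a₃ o : V} {𝓔 : Set (Set V)} (h𝓔 : IsUpperSet 𝓔)
    (hchain : ∀ P P' : (openGraph ends (fun _ => true)).Path a₁ a₃,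
      a₂ ∉ P.1.support → a₂ ∉ P'.1.support →
      P.1.support.toFinset ⊆ P'.1.support.toFinset ∨ P'.1.support.toFinset ⊆ P.1.support.toFinset) :
    prob p ((connEvent ends a₁ a₂)ᶜ ∩ clusterInEvent ends a₁ 𝓔 ∩ connEvent ends a₁ a₃ ∩
          connEvent ends a₂ o) * prob p ((connEvent ends a₁ a₂)ᶜ ∩ connEvent ends a₁ a₃) ≤
      prob p ((connEvent ends a₁ a₂)ᶜ ∩ clusterInEvent ends a₁ 𝓔 ∩ connEvent ends a₁ a₃) *
        prob p ((connEvent ends a₁ a₂)ᶜ ∩ connEvent ends a₁ a₃ ∩ connEvent ends a₂ o) := by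
  classical
  -- every dart of the full graph comes from an edge
  have hdart : ∀ d : (openGraph ends (fun _ => true)).Dart, ∃ b : E, ends b = s(d.fst, d.snd) := by
    intro d
    obtain ⟨_, b, _, hb⟩ := openGraph_adj.1 d.adj
    exact ⟨b, hb⟩
  choose edgeOf hedgeOf using hdart
  -- the simple paths avoiding `a₂`, listed by increasing length
  set 𝓟 : Finset ((openGraph ends (fun _ => true)).Path a₁ a₃) :=
    Finset.univ.filter (fun P => a₂ ∉ P.1.support) with h𝓟
  set l : List ((openGraph ends (fun _ => true)).Path a₁ a₃) :=
    𝓟.toList.mergeSort (fun P P' => decide (P.1.length ≤ P'.1.length)) with hl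
  have hsorted : l.Pairwise (fun P P' => P.1.length ≤ P'.1.length) := by
    have := List.pairwise_mergeSort (le := fun P P' => decide (P.1.length ≤ P'.1.length))
      (fun a b c h₁ h₂ => by simpa using le_trans (by simpa using h₁) (by simpa using h₂))
      (fun a b => by simpa using le_total a.1.length b.1.length) 𝓟.toList
    simpa using this
  have hmem : ∀ P, P ∈ l ↔ a₂ ∉ P.1.support := by
    intro P
    rw [hl, (List.mergeSort_perm _ _).mem_iff, Finset.mem_toList, h𝓟, Finset.mem_filter]
    simp
  -- the routes: the darts of the `i`-th path as triples
  set L : ℕ → List (E × V × V) := fun i =>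
    if h : i < l.length then (l[i]'h).1.darts.map (fun d => (edgeOf d, d.fst, d.snd)) else [] with hL
  have hLi : ∀ i (h : i < l.length),
      L i = (l[i]'h).1.darts.map (fun d => (edgeOf d, d.fst, d.snd)) := by
    intro i h
    simp [hL, h]
  -- the vertex set of a route is the support of the path
  have hS : ∀ i (h : i < l.length),
      (L i).foldl (fun acc t => insert t.2.2 acc) ({a₁} : Finset V) = (l[i]'h).1.support.toFinset := by
    intro i h
    ext v
    rw [CDNestedFan.mem_foldl_insert_verts, hLi i h, List.mem_toFinset,
      SimpleGraph.Walk.mem_support_iff, ← SimpleGraph.Walk.map_snd_darts, List.mem_map,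
      Finset.mem_singleton]
    constructor
    · rintro (rfl | ⟨t, ht, rfl⟩)
      · exact Or.inl rfl
      · rw [List.mem_map] at ht
        obtain ⟨d, hd, rfl⟩ := ht
        exact Or.inr ⟨d, hd, rfl⟩
    · rintro (rfl | ⟨d, hd, rfl⟩)
      · exact Or.inl rfl
      · exact Or.inr ⟨(edgeOf d, d.fst, d.snd), List.mem_map.2 ⟨d, hd, rfl⟩, rfl⟩
  refine ac_of_nested_paths p hp hinj l.length L
    (fun i => (L i).foldl (fun acc t => insert t.1 acc) ∅)
    (fun i => (L i).foldl (fun acc t => insert t.2.2 acc) {a₁}) (fun _ _ => rfl) (fun _ _ => rfl)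
    ?_ ?_ ?_ ?_ h𝓔 ?_
  · -- the ends of the route edges
    intro i hi t ht
    rw [hLi i hi, List.mem_map] at ht
    obtain ⟨d, _, rfl⟩ := ht
    exact hedgeOf d
  · -- walk-ordered from `a₁`: the darts are chained and the first starts at `a₁`
    intro i hi
    refine CDNestedFan.walk_of_isChain (L i) {a₁} ?_ ?_
    · intro t ht
      rw [hLi i hi] at ht
      rw [Finset.mem_singleton]
      have hsupp := SimpleGraph.Walk.map_fst_darts_append (l[i]'hi).1
      rw [← SimpleGraph.Walk.cons_tail_support] at hsupp
      rcases hd : (l[i]'hi).1.darts with _ | ⟨d, ds⟩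
      · rw [hd, List.map_nil, List.head?_nil] at ht
        exact (Option.not_mem_none t ht).elim
      · rw [hd] at ht hsupp
        simp only [List.map_cons, List.head?_cons, Option.mem_def, Option.some.injEq] at ht
        subst ht
        simp only [List.map_cons, List.cons_append, List.cons.injEq] at hsupp
        exact hsupp.1
    · rw [hLi i hi, List.isChain_map]
      refine (SimpleGraph.Walk.isChain_dartAdj_darts (l[i]'hi).1).imp ?_
      intro d d' hdd'
      exact hdd'.symm
  · -- every route reaches `a₃`
    intro i hi
    rw [hS i hi, List.mem_toFinset]
    exact SimpleGraph.Walk.end_mem_support _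
  · -- the vertex sets are nested along the sorted list
    intro j i hji hi
    have hj : j < l.length := lt_trans hji hi
    rw [hS j hj, hS i hi]
    have hPj : a₂ ∉ (l[j]'hj).1.support := (hmem _).1 (List.getElem_mem hj)
    have hPi : a₂ ∉ (l[i]'hi).1.support := (hmem _).1 (List.getElem_mem hi)
    have hlen : (l[j]'hj).1.length ≤ (l[i]'hi).1.length :=
      List.pairwise_iff_getElem.1 hsorted j i hj hi hji
    rcases hchain _ _ hPj hPi with h | h
    · exact h
    · -- the later path is inside the earlier one: equal cardinalities force equality
      have hcard : (l[i]'hi).1.support.toFinset.card ≤ (l[j]'hj).1.support.toFinset.card :=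
        Finset.card_le_card h
      rw [List.toFinset_card_of_nodup (l[i]'hi).2.support_nodup,
        List.toFinset_card_of_nodup (l[j]'hj).2.support_nodup, SimpleGraph.Walk.length_support,
        SimpleGraph.Walk.length_support] at hcard
      have heq : (l[i]'hi).1.support.toFinset = (l[j]'hj).1.support.toFinset := by
        refine Finset.eq_of_subset_of_card_le h ?_
        rw [List.toFinset_card_of_nodup (l[i]'hi).2.support_nodup,
          List.toFinset_card_of_nodup (l[j]'hj).2.support_nodup, SimpleGraph.Walk.length_support,
          SimpleGraph.Walk.length_support]
        omega
      rw [heq]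
  · -- every simple path avoiding `a₂` is one of the routes
    intro W hW ha₂
    have hWl : (⟨W, hW⟩ : (openGraph ends (fun _ => true)).Path a₁ a₃) ∈ l := (hmem _).2 ha₂
    obtain ⟨i, hi, hWi⟩ := List.mem_iff_getElem.1 hWl
    refine ⟨i, hi, fun b hb => ?_⟩
    rw [CDNestedInternal.mem_foldl_insert_edges, hLi i hi] at hb
    rcases hb with hb | ⟨t, ht, rfl⟩
    · exact absurd hb (Finset.notMem_empty b)
    · rw [List.mem_map] at ht
      obtain ⟨d, hd, rfl⟩ := ht
      rw [hWi] at hd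
      rw [hedgeOf d]
      simp only [SimpleGraph.Walk.edges, List.mem_map]
      exact ⟨d, hd, rfl⟩

end SimplePaths

end CDNestedAC

end Summit.Ventures.PercRepro2
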